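import Summits.Ventures.Crystal3D.Theorems.StickyWulffConstantCoaxialWallLawSeamGradedRow
import Summits.Ventures.Crystal3D.Theorems.StickyWulffConstantCoaxialWallLawRowsOfJoint
import Summits.Ventures.Crystal3D.Theorems.StickyWulffConstantCoaxialWallLawEndRowRootDefs
import HarnessLib

/-!
# The BI-FRAME graded certificate (named input for lane T's two-plate pooling) and its LINK: `ThreePayer → BiFrameGradedCapWin₃ s → EndRowBiFrameRootA v2 s`
# (crux `CoaxialWallLaw`, stmt-Ventures-19481, line `WallLedgerF`; serves lane T's (β) two-plate pooling, cf-p1 RULING (ccc)(2)(ii), 2026-08-29)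

HONEST FRAMING. Venture `Summits/Ventures/Crystal3D` (cell `crystal3d-full`); sequel of '…SeamGradedRow' (p744070).  CONDITIONAL on lane F's named input
`TailResidue.ThreePayer` and on the NEW named input below; nothing is proved about either.  Lane F's graded certificate `UnionCoreGradedCapWin₃ s` is a
SINGLE-FAMILY statement: the second plate system is the basal half-turn image `H ≫ L` of the first.  Lane T's (β) two-plate pooling
('…TexShadowLevelReachHexagonGradedGlue' TRIPWIRE, cf-p1 (ccc)(1)) applies ONE local row to the pair of systems of two UNRELATED grains, i.e. it consumes
`EndRowBiFrameRootA v sF` ('…EndRowRootDefs': the ROOT-CLASS local row for every frame pair `(⟨G₁, inPlaneRoots G₁ 1⟩, ⟨G₂, inPlaneRoots G₂ (−1)⟩)`).  THIS FILE: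
* **`BiFrameGradedCapWin₃ s`** (NAMED INPUT, certificate-shaped, the bi-frame strengthening of `UnionCoreGradedCapWin₃ s`): for EVERY relative frame `M` and every
  finite `1`-separated `Y ⊆ B̄(0, 3)` with the payer `0 ∈ Y` of degree `≤ 11`, the graded floor-3 (A)-summand (`v2`, systems `basalSystem refl`, `basalSystem M`) of the
  star-closed union core is `≤ s`;  `biFrameGradedCapWin₃_mono`, `unionCoreGradedCapWin₃_of_biFrame` (`M :=` the basal half-turn recovers lane F's input);
* **`localSummandA_le_of_threePayer_of_biFrameWin₃`** — `ThreePayer → BiFrameGradedCapWin₃ s → Σ_A(Y, z) ≤ s` for EVERY pair of frames `(basalSystem L₁, basalSystem L₂)`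
  and every payer (transport by `L₁`, `M := L₂ ≫ L₁⁻¹`, radius-`3` locality — verbatim the packaging of `localSummandA_le_of_threePayer_of_gradedWin₃`; `ThreePayer`
  transfers unchanged: it is stated for (A)-end pairs of arbitrary slot-rooted systems);
* `localEndRowA_basal_of_biFrameWin₃`, `localEndRowA_inPlane_of_biFrameWin₃` (antitonicity `inPlaneRoots ⊆ basalHexagon`, '…RowsOfJoint'),
  **`endRowBiFrameRootA_of_biFrameWin₃ : ThreePayer → BiFrameGradedCapWin₃ s → EndRowBiFrameRootA WordVersion.v2 s`** (root row ≤ (A) row, `localEndRowRootA_of_localEndRowA`).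
The input counts ALL (A)-end pairs of both systems; a certificate restricted to root-class moves would be weaker still (not typed here: the core lemmas of
'…SeamUnionCore' are stated for (A)-pairs).  Numerics of record for the bi-family functional: 19481-p1 g21 BIFAM-PROBE j336468 «max F = 4282/2737 = 1.565 < 9/2»
(coincidence classes, depth 1).  Why it might fail: a bi-family window with `≥ 15` genuine (A)-ends of the two unrelated systems within `1` of one payer.
WHAT THIS IS NOT: neither input is proved; no lane-T stub is closed; F-C1 not moved.
-/

noncomputable section

namespace Summit.Ventures.Crystal3D.Theorems

namespace TailResidue

open Summit.Ventures.Crystal3D Finset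
open scoped InnerProductSpace

/-! ### The bi-frame certificate -/

open scoped Classical in
/-- **BI-FRAME STAR-CLOSED UNION-CORE CERTIFICATE, GRADED ROW, FLOOR 3, WINDOW FORM (named input).**  For every relative frame `M`, every finite `1`-separated
`Y ⊆ B̄(0, 3)` containing the payer `0` with degree `≤ 11`: the graded floor-3 (A)-summand (`v2`, systems `basalSystem refl` and `basalSystem M`) of the star-closed
union core of `0` is `≤ s`. -/
def BiFrameGradedCapWin₃ (s : ℝ) : Prop :=
  ∀ M : EuclideanSpace ℝ (Fin 3) ≃ₗᵢ[ℝ] EuclideanSpace ℝ (Fin 3),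
  ∀ Y : Finset (EuclideanSpace ℝ (Fin 3)), (∀ y ∈ Y, dist (0 : EuclideanSpace ℝ (Fin 3)) y ≤ 3) → (∀ p ∈ Y, ∀ q ∈ Y, p ≠ q → 1 ≤ dist p q) →
  (0 : EuclideanSpace ℝ (Fin 3)) ∈ Y → (Y.filter fun q => dist (0 : EuclideanSpace ℝ (Fin 3)) q = 1).card ≤ 11 →
    gradedSummand₃ WordVersion.v2 (basalSystem (LinearIsometryEquiv.refl ℝ (EuclideanSpace ℝ (Fin 3)))) (basalSystem M) Y
      (unionCoreStar Y 0 WordVersion.v2 (basalSystem (LinearIsometryEquiv.refl ℝ (EuclideanSpace ℝ (Fin 3)))) (basalSystem M)) 0 ≤ s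

/-- Monotonicity in the line. -/
theorem biFrameGradedCapWin₃_mono {s s' : ℝ} (h : BiFrameGradedCapWin₃ s) (hs : s ≤ s') : BiFrameGradedCapWin₃ s' :=
  fun M Y hW hY h0 hdeg => (h M Y hW hY h0 hdeg).trans hs

/-- The bi-frame certificate contains lane F's single-family certificate (`M :=` the basal half-turn). -/
theorem unionCoreGradedCapWin₃_of_biFrame {s : ℝ} (h : BiFrameGradedCapWin₃ s) : UnionCoreGradedCapWin₃ s :=
  fun Y hW hY h0 hdeg => h _ Y hW hY h0 hdeg

/-! ### The link: every pair of frames, every payer -/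

open scoped Classical in
/-- **`ThreePayer → BiFrameGradedCapWin₃ s → Σ_A(Y, z) ≤ s` for EVERY PAIR of basal frames and every payer** (transport `z ↦ 0`, `L₁ ↦ refl`, `L₂ ↦ L₂ ≫ L₁⁻¹`;
radius-`3` locality). -/
theorem localSummandA_le_of_threePayer_of_biFrameWin₃ (h3 : ThreePayer) {s : ℝ} (h : BiFrameGradedCapWin₃ s)
    (L₁ L₂ : EuclideanSpace ℝ (Fin 3) ≃ₗᵢ[ℝ] EuclideanSpace ℝ (Fin 3)) {Y : Finset (EuclideanSpace ℝ (Fin 3))} (hY : ∀ p ∈ Y, ∀ q ∈ Y, p ≠ q → 1 ≤ dist p q)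
    {z : EuclideanSpace ℝ (Fin 3)} (hz : z ∈ Y) (hdeg : (Y.filter fun q => dist z q = 1).card ≤ 11) :
    localSummandA WordVersion.v2 (basalSystem L₁) (basalSystem L₂) Y z ≤ s := by
  set M : EuclideanSpace ℝ (Fin 3) ≃ₗᵢ[ℝ] EuclideanSpace ℝ (Fin 3) := L₂.trans L₁.symm with hM
  have hML : M.trans L₁ = L₂ := by ext x; simp [hM]
  set X := Y.image fun y => L₁.symm y + -L₁.symm z with hXdef
  have hX : ∀ p ∈ X, ∀ q ∈ X, p ≠ q → 1 ≤ dist p q := separated_image_rigid hY L₁.symm _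
  have hYX : Y = X.image fun x => L₁ x + z := by
    have e := image_rigid_symm Y L₁.symm (-L₁.symm z)
    simp only [LinearIsometryEquiv.symm_symm, map_neg, LinearIsometryEquiv.apply_symm_apply, neg_neg] at e
    rw [hXdef, e]
  have h0 : (0 : EuclideanSpace ℝ (Fin 3)) ∈ X := mem_image.2 ⟨z, hz, by simp⟩
  have hzz : z = L₁ 0 + z := by simp
  have hdeg0 : (X.filter fun q => dist (0 : EuclideanSpace ℝ (Fin 3)) q = 1).card ≤ 11 := by
    rw [← degree_transport X L₁ z 0, ← hYX, ← hzz]; exact hdeg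
  have key := localSummandA_transport X L₁ z WordVersion.v2 (LinearIsometryEquiv.refl ℝ (EuclideanSpace ℝ (Fin 3))) M basalHexagon basalHexagon 0
  rw [← hYX, ← hzz, LinearIsometryEquiv.refl_trans, hML] at key
  change localSummandA WordVersion.v2 ⟨L₁, basalHexagon⟩ ⟨L₂, basalHexagon⟩ Y z ≤ s
  rw [key]
  set X₀ := X.filter fun x => dist (0 : EuclideanSpace ℝ (Fin 3)) x ≤ 3 with hX₀def
  have hagree : ∀ x, dist (0 : EuclideanSpace ℝ (Fin 3)) x ≤ 3 → (x ∈ X ↔ x ∈ X₀) := fun x hx => by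
    rw [hX₀def, mem_filter]; exact ⟨fun h => ⟨h, hx⟩, fun h => h.1⟩
  have h₁ : (basalSystem (LinearIsometryEquiv.refl ℝ (EuclideanSpace ℝ (Fin 3)))).RT ⊆ fccSlots := filter_subset _ _
  have h₂ : (basalSystem M).RT ⊆ fccSlots := filter_subset _ _
  have hloc := localSummandA_congr_of_agree (v := WordVersion.v2) hagree h₁ h₂ (z := 0) (by simp)
  change localSummandA WordVersion.v2 (basalSystem (LinearIsometryEquiv.refl ℝ (EuclideanSpace ℝ (Fin 3)))) (basalSystem M) X 0 ≤ s
  rw [hloc]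
  have hX₀ : ∀ p ∈ X₀, ∀ q ∈ X₀, p ≠ q → 1 ≤ dist p q := fun p hp q hq hne => hX p (mem_filter.1 hp).1 q (mem_filter.1 hq).1 hne
  have hW : ∀ y ∈ X₀, dist (0 : EuclideanSpace ℝ (Fin 3)) y ≤ 3 := fun y hy => (mem_filter.1 hy).2
  have h00 : (0 : EuclideanSpace ℝ (Fin 3)) ∈ X₀ := mem_filter.2 ⟨h0, by simp⟩
  have hdeg00 : (X₀.filter fun q => dist (0 : EuclideanSpace ℝ (Fin 3)) q = 1).card ≤ 11 := by
    rw [← degree_congr_of_agree hagree (y := 0) (by simp)]; exact hdeg0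
  exact (localSummandA_le_gradedSummand₃_unionCoreStar h3 hX₀ h₁ h₂ h00 hdeg00).trans (h M X₀ hW hX₀ h00 hdeg00)

/-- **… ⇒ the (A) local row for every pair of basal frames.** -/
theorem localEndRowA_basal_of_biFrameWin₃ (h3 : ThreePayer) {s : ℝ} (h : BiFrameGradedCapWin₃ s) (L₁ L₂ : EuclideanSpace ℝ (Fin 3) ≃ₗᵢ[ℝ] EuclideanSpace ℝ (Fin 3)) :
    LocalEndRowA WordVersion.v2 s (basalSystem L₁) (basalSystem L₂) :=
  fun _ hX _ hz hdeg => localSummandA_le_of_threePayer_of_biFrameWin₃ h3 h L₁ L₂ hX hz hdeg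

/-- **… ⇒ the (A) local row for the in-plane systems of any two frames** (bottom: rising roots; top: falling roots; antitonicity in the admissible classes). -/
theorem localEndRowA_inPlane_of_biFrameWin₃ (h3 : ThreePayer) {s : ℝ} (h : BiFrameGradedCapWin₃ s) (G₁ G₂ : EuclideanSpace ℝ (Fin 3) ≃ₗᵢ[ℝ] EuclideanSpace ℝ (Fin 3)) :
    LocalEndRowA WordVersion.v2 s ⟨G₁, inPlaneRoots G₁ 1⟩ ⟨G₂, inPlaneRoots G₂ (-1)⟩ := by
  refine localEndRowA_of_systems (S₁' := basalSystem G₁) (S₂' := basalSystem G₂) ?_ (localEndRowA_basal_of_biFrameWin₃ h3 h G₁ G₂)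
  rintro G d (hG | hG)
  · exact Or.inl (PlateSystem.adm_mono (inPlaneRoots_subset_basalHexagon G₁ 1) hG)
  · exact Or.inr (PlateSystem.adm_mono (inPlaneRoots_subset_basalHexagon G₂ (-1)) hG)

/-- **THE LINK (cf-p1 (ccc)(2)(ii))**: `ThreePayer → BiFrameGradedCapWin₃ s → EndRowBiFrameRootA v2 s` — the bi-frame ROOT-CLASS row that lane T's (β) two-plate
pooling consumes, at the certificate's line (the root row only removes pairs from the (A) row). -/
theorem endRowBiFrameRootA_of_biFrameWin₃ (h3 : ThreePayer) {s : ℝ} (h : BiFrameGradedCapWin₃ s) : EndRowBiFrameRootA WordVersion.v2 s :=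
  fun G₁ G₂ => localEndRowRootA_of_localEndRowA (localEndRowA_inPlane_of_biFrameWin₃ h3 h G₁ G₂)

/-- The instance lane T needs (cf-p1 (ccc)(1): the (β) census is pooled at the line `9/2`). -/
theorem endRowBiFrameRootA_nine_halves (h3 : ThreePayer) (h : BiFrameGradedCapWin₃ (9 / 2)) : EndRowBiFrameRootA WordVersion.v2 (9 / 2) :=
  endRowBiFrameRootA_of_biFrameWin₃ h3 h

end TailResidue

end Summit.Ventures.Crystal3D.Theorems

end
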